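import Literature.Analysis.FluidPDE.LerayHopf
import Literature.Analysis.FluidPDE.DoeringFoiasPowerProofs
import Literature.Analysis.FunctionSpaces.TorusHolderSobolevEmbedding
import Literature.Analysis.FunctionSpaces.TorusSobolevNormFacts
import Literature.Analysis.FunctionSpaces.TorusSobolevNormSmoothProofs
import Literature.Analysis.FunctionSpaces.TorusConvolution
import Literature.Analysis.FunctionSpaces.TorusTrigPoly
import Literature.Analysis.FunctionSpaces.TorusLerayHelmholtzSpaceTime
import Literature.Analysis.FunctionSpaces.TorusRieszFischerParam
import HarnessLib

/-!
# Galilean change of frame on the flat torus — slice calculus (tools)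

Analysis/FluidPDE support file (all proved).  For a velocity field `w : T^d → ℝ^d`, a torus point `a` and a
constant velocity `V`, the slice of a Galilean change of frame is the field `y ↦ w (y + a) - V` ("translate, then
subtract the frame velocity").  This file records how the slice functionals of the Leray–Hopf energy class
transform under it:

* `Torus.memLp_comp_add_right_sub_const`, `Torus.integrable_comp_add_right_sub_const` — `L^p` / integrability;
* `Torus.lintegral_enorm_sq_comp_add_right_sub_const_le` — `∫⁻ ‖w(· + a) − V‖ₑ² ≤ 2∫⁻‖w‖ₑ² + 2‖V‖ₑ²`;
* `Torus.integral_norm_sq_comp_add_right_sub_const`, `Torus.kineticEnergy_comp_add_right_sub_const` — the exact energy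
  bookkeeping `½∫‖w(· + a) − V‖² = ½∫‖w‖² − ⟪∫ w, V⟫ + ½‖V‖²` (the torus has volume one);
* `Torus.mFourierCoeff_complexify_comp_add_right_sub_const`, `Torus.eGradNormSq_comp_add_right_sub_const` — the spectral
  gradient norm `‖∇·‖₂²` is INVARIANT (a translate multiplies `v̂(k)` by the unimodular character `e_k(a)`, a constant
  only moves the zero mode, which carries the weight `|k|² = 0`);
* `Torus.eSobolevNorm_comp_add_right`, `Torus.memSobolev_comp_add_right_sub_const` — `H^s` membership is preserved;
* `Torus.gradient_comp_add_right`, `Torus.isWeaklyDivFree_comp_add_right_sub_const` — weak incompressibility is preserved.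

These are the slice-wise ingredients of the Galilean covariance of Leray–Hopf weak solutions
(`LerayHopfGalileanTorus`).  Standard (U. Frisch, *Turbulence* (1995) §2.2–2.3: symmetries of Navier–Stokes,
Galilean invariance on the periodic box).
-/

noncomputable section

open MeasureTheory Set Filter Topology
open scoped InnerProductSpace RealInnerProductSpace ENNReal NNReal

namespace Literature.Analysis.FluidPDE.Torus

open Literature.Analysis.FunctionSpaces Literature.Analysis.FunctionSpaces.Torus UnitAddTorus

variable {d : Type*} [Fintype d] [DecidableEq d]

/-! ### `L^p`, integrals, energy -/

omit [DecidableEq d] in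
/-- Translates and frame shifts stay in `L^p`: `y ↦ w (y + a) - V ∈ L^p` if `w ∈ L^p` (Haar invariance; the torus is a
probability space so constants are in every `L^p`). [folklore] -/
theorem memLp_comp_add_right_sub_const {p : ℝ≥0∞} {w : UnitAddTorus d → EuclideanSpace ℝ d}
    (hw : MemLp w p volume) (a : UnitAddTorus d) (V : EuclideanSpace ℝ d) :
    MemLp (fun y => w (y + a) - V) p volume :=
  (hw.comp_measurePreserving (measurePreserving_add_right volume a)).sub (memLp_const V)

omit [DecidableEq d] in
/-- Translates and frame shifts stay integrable. [folklore] -/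
theorem integrable_comp_add_right_sub_const {w : UnitAddTorus d → EuclideanSpace ℝ d}
    (hw : Integrable w volume) (a : UnitAddTorus d) (V : EuclideanSpace ℝ d) :
    Integrable (fun y => w (y + a) - V) volume :=
  (hw.comp_add_right a).sub (integrable_const V)

omit [DecidableEq d] in
/-- `∫⁻ ‖w(· + a) − V‖ₑ² ≤ 2 ∫⁻ ‖w‖ₑ² + 2 ‖V‖ₑ²` (parallelogram bound and Haar invariance). [folklore] -/
theorem lintegral_enorm_sq_comp_add_right_sub_const_le (w : UnitAddTorus d → EuclideanSpace ℝ d)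
    (a : UnitAddTorus d) (V : EuclideanSpace ℝ d) :
    ∫⁻ y, ‖w (y + a) - V‖ₑ ^ 2 ≤ 2 * (∫⁻ y, ‖w y‖ₑ ^ 2) + 2 * ‖V‖ₑ ^ 2 := by
  have hpt : ∀ y, ‖w (y + a) - V‖ₑ ^ 2 ≤ 2 * ‖w (y + a)‖ₑ ^ 2 + 2 * ‖V‖ₑ ^ 2 := by
    intro y
    have h0 : ‖w (y + a) - V‖ ^ 2 ≤ (‖w (y + a)‖ + ‖V‖) ^ 2 :=
      pow_le_pow_left₀ (norm_nonneg _) (norm_sub_le _ _) 2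
    have h1 : ‖w (y + a) - V‖ ^ 2 ≤ 2 * ‖w (y + a)‖ ^ 2 + 2 * ‖V‖ ^ 2 := by
      nlinarith [h0, sq_nonneg (‖w (y + a)‖ - ‖V‖)]
    have h2 : ENNReal.ofReal (‖w (y + a) - V‖ ^ 2) ≤
        ENNReal.ofReal (2 * ‖w (y + a)‖ ^ 2 + 2 * ‖V‖ ^ 2) := ENNReal.ofReal_le_ofReal h1
    rw [ENNReal.ofReal_add (by positivity) (by positivity), ENNReal.ofReal_mul (by norm_num),
      ENNReal.ofReal_mul (by norm_num), ENNReal.ofReal_ofNat] at h2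
    simpa only [← ofReal_norm, ← ENNReal.ofReal_pow (norm_nonneg _)] using h2
  calc ∫⁻ y, ‖w (y + a) - V‖ₑ ^ 2 ≤ ∫⁻ y, (2 * ‖w (y + a)‖ₑ ^ 2 + 2 * ‖V‖ₑ ^ 2) := lintegral_mono hpt
    _ = 2 * (∫⁻ y, ‖w (y + a)‖ₑ ^ 2) + 2 * ‖V‖ₑ ^ 2 := by
        rw [lintegral_add_right _ measurable_const, lintegral_const_mul' _ _ ENNReal.ofNat_ne_top,
          lintegral_const, measure_univ, mul_one]
    _ = 2 * (∫⁻ y, ‖w y‖ₑ ^ 2) + 2 * ‖V‖ₑ ^ 2 := by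
        rw [lintegral_add_right_eq_self (fun y => ‖w y‖ₑ ^ 2) a]

omit [DecidableEq d] in
/-- **Energy bookkeeping of a frame shift** (`L²` slices): `∫‖w(· + a) − V‖² = ∫‖w‖² − 2⟪∫ w, V⟫ + ‖V‖²`. [folklore] -/
theorem integral_norm_sq_comp_add_right_sub_const {w : UnitAddTorus d → EuclideanSpace ℝ d}
    (hw : MemLp w 2 volume) (a : UnitAddTorus d) (V : EuclideanSpace ℝ d) :
    ∫ y, ‖w (y + a) - V‖ ^ 2 = (∫ y, ‖w y‖ ^ 2) - 2 * ⟪∫ y, w y, V⟫ + ‖V‖ ^ 2 := by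
  have hwi : Integrable w volume := hw.integrable one_le_two
  have hsq : Integrable (fun y => ‖w y‖ ^ 2) volume := hw.integrable_norm_pow two_ne_zero
  have hpt : ∀ y, ‖w (y + a) - V‖ ^ 2 = ‖w (y + a)‖ ^ 2 - 2 * ⟪w (y + a), V⟫ + ‖V‖ ^ 2 := by
    intro y
    rw [@norm_sub_sq_real]
  simp_rw [hpt]
  have e1 : ∫ y, ‖w (y + a)‖ ^ 2 = ∫ y, ‖w y‖ ^ 2 := integral_add_right_eq_self (fun y => ‖w y‖ ^ 2) a
  have e2 : ∫ y, ⟪w (y + a), V⟫ = ⟪∫ y, w y, V⟫ := by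
    rw [integral_add_right_eq_self (fun y => ⟪w y, V⟫) a]
    have hc : (fun y => ⟪w y, V⟫) = fun y => ⟪V, w y⟫ := funext fun y => real_inner_comm _ _
    rw [hc, integral_inner hwi V, real_inner_comm]
  have i1 : Integrable (fun y => ‖w (y + a)‖ ^ 2) volume := hsq.comp_add_right a
  have i2 : Integrable (fun y => 2 * ⟪w (y + a), V⟫) volume :=
    ((hwi.comp_add_right a).inner_const V).const_mul 2
  have i12 : Integrable (fun y => ‖w (y + a)‖ ^ 2 - 2 * ⟪w (y + a), V⟫) volume := i1.sub i2
  rw [integral_add i12 (integrable_const _), integral_sub i1 i2, integral_const_mul, e1, e2,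
    integral_const, probReal_univ, one_smul]

omit [DecidableEq d] in
/-- **Kinetic energy of a frame shift**: `½∫‖w(· + a) − V‖² = ½∫‖w‖² − ⟪∫ w, V⟫ + ½‖V‖²`. [folklore] -/
theorem kineticEnergy_comp_add_right_sub_const {w : UnitAddTorus d → EuclideanSpace ℝ d}
    (hw : MemLp w 2 volume) (a : UnitAddTorus d) (V : EuclideanSpace ℝ d) :
    kineticEnergy (fun y => w (y + a) - V) = kineticEnergy w - ⟪∫ y, w y, V⟫ + 2⁻¹ * ‖V‖ ^ 2 := by
  unfold kineticEnergy
  rw [integral_norm_sq_comp_add_right_sub_const hw a V]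
  ring

/-! ### Fourier side: constants, translates, the spectral gradient norm and `H^s` -/

section Fourier

variable {F : Type*} [NormedAddCommGroup F] [NormedSpace ℂ F] [CompleteSpace F]

omit [DecidableEq d] in
/-- Fourier coefficients of a constant: `𝓕(x ↦ c)(k) = c` for `k = 0` and `0` otherwise (`∫ e_{-k} = δ_{k,0}`). [folklore] -/
theorem mFourierCoeff_fun_const (c : F) (k : d → ℤ) :
    mFourierCoeff (fun _ : UnitAddTorus d => c) k = if k = 0 then c else 0 := by
  rw [mFourierCoeff_eq_integral_volume, integral_smul_const, integral_mFourier]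
  by_cases hk : k = 0
  · subst hk; simp
  · simp [hk]

omit [DecidableEq d] [CompleteSpace F] in
/-- **The `H^s` norm is translation invariant**: `‖f(· + a)‖_{H^s} = ‖f‖_{H^s}` (each coefficient is multiplied by the
unimodular character `e_k(a)`, `mFourierCoeff_comp_add_right`). [folklore] -/
theorem eSobolevNorm_comp_add_right (s : ℝ) (f : UnitAddTorus d → F) (a : UnitAddTorus d) :
    eSobolevNorm s (fun y => f (y + a)) = eSobolevNorm s f := by
  unfold eSobolevNorm
  congr 1
  refine tsum_congr fun k => ?_
  rw [mFourierCoeff_comp_add_right, enorm_smul, enorm_mFourier_apply, one_mul]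

omit [DecidableEq d] in
/-- The `H^s` norm of a constant is its norm: only the zero mode is present and `⟨0⟩^s = 1`. [folklore] -/
theorem eSobolevNorm_fun_const (s : ℝ) (c : F) : eSobolevNorm s (fun _ : UnitAddTorus d => c) = ‖c‖ₑ := by
  unfold eSobolevNorm
  rw [tsum_eq_single (0 : d → ℤ) (fun k hk => by rw [mFourierCoeff_fun_const, if_neg hk, enorm_zero,
      zero_pow two_ne_zero, mul_zero]),
    mFourierCoeff_fun_const, if_pos rfl, sobolevWeight_apply_zero, one_pow, ENNReal.ofReal_one, one_mul,
    ← ENNReal.rpow_natCast, ← ENNReal.rpow_mul, show ((2 : ℕ) : ℝ) * (1 / 2 : ℝ) = 1 by norm_num,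
    ENNReal.rpow_one]

omit [DecidableEq d] [CompleteSpace F] in
/-- `H^s` membership is translation invariant. [folklore] -/
theorem memSobolev_comp_add_right {s : ℝ} {f : UnitAddTorus d → F} (hf : MemSobolev s f) (a : UnitAddTorus d) :
    MemSobolev s (fun y => f (y + a)) :=
  ⟨hf.1.comp_add_right a, by rw [eSobolevNorm_comp_add_right]; exact hf.2⟩

omit [DecidableEq d] in
/-- Constants lie in every `H^s`. [folklore] -/
theorem memSobolev_fun_const (s : ℝ) (c : F) : MemSobolev s (fun _ : UnitAddTorus d => c) :=
  ⟨integrable_const c, by rw [eSobolevNorm_fun_const]; exact enorm_lt_top⟩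

omit [DecidableEq d] in
/-- `H^s` membership survives a frame shift: `y ↦ f (y + a) - c ∈ H^s` if `f ∈ H^s` (`MemSobolev.sub_holds`). [folklore] -/
theorem memSobolev_comp_add_right_sub_const {s : ℝ} {f : UnitAddTorus d → F} (hf : MemSobolev s f)
    (a : UnitAddTorus d) (c : F) : MemSobolev s (fun y => f (y + a) - c) :=
  MemSobolev.sub_holds (memSobolev_comp_add_right hf a) (memSobolev_fun_const s c)

omit [DecidableEq d] in
/-- Quantitative form: `‖f(· + a) − c‖_{H^s} ≤ ‖f‖_{H^s} + ‖c‖` for integrable `f` (triangle inequality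
`eSobolevNorm_add_le_holds`, translation invariance, and the norm of a constant). [folklore] -/
theorem eSobolevNorm_comp_add_right_sub_const_le (s : ℝ) {f : UnitAddTorus d → F} (hf : Integrable f volume)
    (a : UnitAddTorus d) (c : F) :
    eSobolevNorm s (fun y => f (y + a) - c) ≤ eSobolevNorm s f + ‖c‖ₑ := by
  have h1 : (fun y => f (y + a) - c) = (fun y => f (y + a)) + fun _ => -c := by
    funext y; simp [sub_eq_add_neg]
  rw [h1]
  refine (eSobolevNorm_add_le_holds (hf.comp_add_right a) (integrable_const _)).trans ?_
  rw [eSobolevNorm_comp_add_right, eSobolevNorm_fun_const, enorm_neg]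

end Fourier

omit [DecidableEq d] in
/-- **Fourier coefficients of a frame-shifted slice** (complexified real field, `w` integrable):
`𝓕(w(· + a) − V)(k) = e_k(a) • ŵ(k) − δ_{k,0} V`. [folklore] -/
theorem mFourierCoeff_complexify_comp_add_right_sub_const {w : UnitAddTorus d → EuclideanSpace ℝ d}
    (hw : Integrable w volume) (a : UnitAddTorus d) (V : EuclideanSpace ℝ d) (k : d → ℤ) :
    mFourierCoeff (EuclideanSpace.complexify ∘ fun y => w (y + a) - V) k =
      mFourier k a • mFourierCoeff (EuclideanSpace.complexify ∘ w) k -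
        (if k = 0 then EuclideanSpace.complexify V else 0) := by
  have hsplit : (EuclideanSpace.complexify ∘ fun y => w (y + a) - V) =
      (fun y => (EuclideanSpace.complexify ∘ w) (y + a)) - fun _ => EuclideanSpace.complexify V := by
    funext y
    simp only [Function.comp_apply, Pi.sub_apply, map_sub]
  have hi : Integrable (EuclideanSpace.complexify ∘ w) volume :=
    (EuclideanSpace.complexify (ι := d)).toContinuousLinearMap.integrable_comp hw
  rw [hsplit, mFourierCoeff_sub (hi.comp_add_right a) (integrable_const _), mFourierCoeff_comp_add_right,
    mFourierCoeff_fun_const]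

omit [DecidableEq d] in
/-- **The spectral gradient norm is Galilean invariant on slices**: `‖∇(w(· + a) − V)‖₂² = ‖∇w‖₂²` for integrable
`w` (translation multiplies `ŵ(k)` by the unimodular `e_k(a)`; the constant only moves the zero mode, of weight `|0|² = 0`).
[folklore] -/
theorem eGradNormSq_comp_add_right_sub_const {w : UnitAddTorus d → EuclideanSpace ℝ d}
    (hw : Integrable w volume) (a : UnitAddTorus d) (V : EuclideanSpace ℝ d) :
    eGradNormSq (fun y => w (y + a) - V) = eGradNormSq w := by
  have h : ∀ k : d → ℤ,
      (if k = 0 then 0 else ENNReal.ofReal (freqNormSq k ^ (1 : ℝ))) *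
          ‖mFourierCoeff (EuclideanSpace.complexify ∘ fun y => w (y + a) - V) k‖ₑ ^ 2 =
        (if k = 0 then 0 else ENNReal.ofReal (freqNormSq k ^ (1 : ℝ))) *
          ‖mFourierCoeff (EuclideanSpace.complexify ∘ w) k‖ₑ ^ 2 := by
    intro k
    by_cases hk : k = 0
    · simp [hk]
    · rw [mFourierCoeff_complexify_comp_add_right_sub_const hw, if_neg hk, if_neg hk, sub_zero, enorm_smul,
        enorm_mFourier_apply, one_mul]
  simp only [eGradNormSq, eHomSobolevSeminorm]
  rw [tsum_congr h]

omit [DecidableEq d] in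
/-- The spectral gradient norm is translation invariant (case `V = 0`). [folklore] -/
theorem eGradNormSq_comp_add_right {w : UnitAddTorus d → EuclideanSpace ℝ d} (hw : Integrable w volume)
    (a : UnitAddTorus d) : eGradNormSq (fun y => w (y + a)) = eGradNormSq w := by
  simpa using eGradNormSq_comp_add_right_sub_const hw a 0

/-! ### Weak incompressibility -/

omit [DecidableEq d] in
/-- The torus gradient of a translate is the translate of the gradient: `∇(θ(· + b))(x) = ∇θ (x + b)`
(the re-centred lifts agree, `liftAt (θ(· + b)) x = liftAt θ (x + b)`). [folklore] -/
theorem gradient_comp_add_right (θ : UnitAddTorus d → ℝ) (b x : UnitAddTorus d) :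
    Torus.gradient (fun z => θ (z + b)) x = Torus.gradient θ (x + b) := by
  unfold Torus.gradient
  congr 1
  funext v
  simp only [liftAt_apply, add_right_comm]

omit [DecidableEq d] in
/-- **Weak incompressibility survives a frame shift**: if `w ∈ L¹` is weakly divergence free, so is
`y ↦ w (y + a) - V` — test `θ` against the shifted field by testing `θ(· − a)` against `w`, and `∫ ∇θ = 0` kills the
constant. [folklore] -/
theorem isWeaklyDivFree_comp_add_right_sub_const {w : UnitAddTorus d → EuclideanSpace ℝ d}
    (hw : FunctionSpaces.Torus.IsWeaklyDivFree w) (hwi : Integrable w volume) (a : UnitAddTorus d)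
    (V : EuclideanSpace ℝ d) : FunctionSpaces.Torus.IsWeaklyDivFree (fun y => w (y + a) - V) := by
  intro θ hθ
  have hθa : IsSmooth (fun z => θ (z + -a)) := hθ.comp_add_right (-a)
  have hgc : Continuous (Torus.gradient θ) := hθ.gradient.continuous
  have i1 : Integrable (fun y => ⟪w (y + a), Torus.gradient θ y⟫) volume :=
    integrable_inner_of_continuous (hwi.comp_add_right a) hgc
  have i2 : Integrable (fun y => ⟪V, Torus.gradient θ y⟫) volume :=
    integrable_inner_of_continuous (integrable_const V) hgc
  have hsplit : (fun y => ⟪w (y + a) - V, Torus.gradient θ y⟫) =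
      fun y => ⟪w (y + a), Torus.gradient θ y⟫ - ⟪V, Torus.gradient θ y⟫ := by
    funext y; rw [inner_sub_left]
  rw [hsplit, integral_sub i1 i2]
  -- the translate: test `θ(· - a)` against `w`
  have h1 : ∫ y, ⟪w (y + a), Torus.gradient θ y⟫ = 0 := by
    have e : (fun y => ⟪w (y + a), Torus.gradient θ y⟫) =
        fun y => (fun z => ⟪w z, Torus.gradient (fun z' => θ (z' + -a)) z⟫) (y + a) := by
      funext y
      simp only [gradient_comp_add_right, add_neg_cancel_right]
    rw [e, integral_add_right_eq_self (fun z => ⟪w z, Torus.gradient (fun z' => θ (z' + -a)) z⟫) a]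
    exact hw _ hθa
  -- the constant: `∫ ∇θ = 0`
  have h2 : ∫ y, ⟪V, Torus.gradient θ y⟫ = 0 := by
    rw [integral_inner hθ.gradient.integrable V, integral_gradient_eq_zero hθ, inner_zero_right]
  rw [h1, h2, sub_zero]

end Literature.Analysis.FluidPDE.Torus
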